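import Summits.CriticalPhenomena.CardyFormulaZ2.Theses.CardyUniqueLimit
import Summits.CriticalPhenomena.CardyFormulaZ2.Theorems.CardySelfRefinementLagHandOffDiscretisable
import Summits.CriticalPhenomena.CardyFormulaZ2.Theorems.CardyUniqueLimitCardyRigidityDefs
import Summits.CriticalPhenomena.CardyFormulaZ2.Theorems.CardyUniqueLimitCardyRigidityStubKernelFacts
import Summits.CriticalPhenomena.CardyFormulaZ2.Theorems.CardyUniqueLimitCardyRigidityBetaLawPin
import Summits.CriticalPhenomena.CardyFormulaZ2.Theorems.CardyUniqueLimitCardyRigidityStubKernelAffineCardy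
import Summits.CriticalPhenomena.CardyFormulaZ2.Theorems.CardyUniqueLimitCardyRigidityDriverHalf
import Summits.CriticalPhenomena.CardyFormulaZ2.Theorems.CardyComplexConeParafermionToSLESixFamiliesFaceKernelPercFaceK1
import Summits.CriticalPhenomena.CardyFormulaZ2.Theorems.CardyUniqueLimitCardyRigidityLevelExtension
import Summits.CriticalPhenomena.CardyFormulaZ2.Theorems.CardyUniqueLimitCardyRigidityOrientedDisc
import Summits.CriticalPhenomena.CardyFormulaZ2.Theorems.CardyUniqueLimitCardyRigiditySlitCrossingClockForm
import Summits.CriticalPhenomena.CardyFormulaZ2.Theorems.CardyUniqueLimitCardyRigiditySlitCrossingClockAssembly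
import Summits.CriticalPhenomena.CardyFormulaZ2.Theorems.CardyUniqueLimitCardyRigidityMartingaleOfData
import Summits.CriticalPhenomena.CardyFormulaZ2.Theorems.CardyUniqueLimitCardyRigidityPercDrivingTailOfFace
import Summits.CriticalPhenomena.CardyFormulaZ2.Theorems.CardyUniqueLimitCardyRigidityFaceHalfPlaneG2OfTransfer
import Summits.CriticalPhenomena.CardyFormulaZ2.Theorems.CardyUniqueLimitCardyRigidityCapacityClockDefs
import Summits.CriticalPhenomena.CardyFormulaZ2.Theorems.CardyUniqueLimitCardyRigidityStubPercCapacityClock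
import Literature.Probability.RandomPlanarGeometry.DrivingFunctionMeasurable
import Literature.Probability.Percolation.InterfaceTraversalBoundData4
import Literature.Probability.Percolation.BondInterfaceMeasurability
import Literature.Probability.RandomPlanarGeometry.SLELawOfDrivingProcess
import Literature.Probability.RandomPlanarGeometry.CaratheodoryHalfPlaneProofs
import Literature.Probability.RandomPlanarGeometry.SLEConvergenceCriterion
import Literature.Probability.RandomPlanarGeometry.ObservableDiscretePassageAE
import HarnessLib

/-!
# Line `crossing-martingale` — skeleton v10 for crux `CardyRigidity` (stmt-CriticalPhenomena-0746)

    CardyRigidity := ∀ f, (∀ R, R.HasCrossingLimit (bondDomainCrossingProb R) f) → EqOn f F (Ioo 0 1)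

(registered crux decl `Summit.CriticalPhenomena.CardyFormulaZ2.Theses.CardyUniqueLimit.CardyRigidity`; the same
`Prop` in all nine route files that want the item.)

## v10 (lead c2, 2026-08-17): STUB A3a `stub_percCapacityClock : PercCapacityClockH` LANDED (p165367) and imported — open stubs: A1
`stub_percBoxTight`, A2‴ `stub_percFaceAnnulusTransfer`, A3b `stub_slitObservableApprox`; STUB A, A2, A2″, A3, A3a, A4 are theorems.

## v9 (lead c2, 2026-08-17, wave 2): A3a is re-registered in the HORIZON FORM `stub_percCapacityClock : PercCapacityClockH`
(worker W2a: the v8 form over-specified the identification clause; the horizon form is PROVED in the worker's final file, to be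
landed as `Theorems/CardyUniqueLimitCardyRigidityStubPercCapacityClock.lean`; glue landed p163717 NonStall, p163761 Steps,
p163934 CapacityClockDefs with the re-proved cut `capClock_percCrossingClockForm_ofH`).  A2″ `Driver.PercFaceHalfPlaneG2` becomes
the THEOREM `percFaceHalfPlaneG2_of_stubs` modulo A2‴ `stub_percFaceAnnulusTransfer : Driver.PercFaceAnnulusTransfer` (worker
W2c landed the probabilistic half p163162 + length–area pieces p163896 …).  A3b pieces landed by worker W2b: p162527 EventIdentity,
p163049/p163254 Bulk, p163805 TipNegligible.  Open: A1, A2‴, A3a (proof ready), A3b.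

## v8 (lead c2, 2026-08-17): STUB A2 `stub_percDrivingTail` becomes the THEOREM `percDrivingTail_of_stubs` modulo A1 and the new
A2″ `stub_percFaceHalfPlaneG2 : Driver.PercFaceHalfPlaneG2` (KS Condition G2 in `ℍ` for the canonical face-domain system)
through worker A2's landed bridge (…KSRectangleExitBounded p158404, …PercDrivingTight p158482 [rate-free tightness from box
tightness — answers why the registered A2 is not provable from its own hypotheses], …PercDrivingTailOfG2 p158982,
…PercDrivingTailOfLimitG2 p159735, …PercDrivingTailOfFace p161145).  Open: A1, A2″, A3a, A3b — STUB A and the crux are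
theorems modulo these four.

## v7 (lead c2, 2026-08-17): STUB A4 `stub_martingaleOfData` LANDED (worker A4: …MartingaleOfDataFlow/Path/Continuity +
…MartingaleOfData.lean); STUB A3 `stub_slitCrossingData` becomes the THEOREM `slitCrossingData_of_stubs` modulo A3a
`stub_percCapacityClock : PercCapacityClock` (kernel-free capacity clock, shared with crux 11389) and A3b
`stub_slitObservableApprox : ∀ f, AllRectangleKernel f → PercSlitObservableApprox f` (the heart), through the landed cut
`percCrossingClockForm_of` (…SlitCrossingClockAssembly.lean, worker A3) and packaging `slitCrossing_data_of_clockForm`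
(…SlitCrossingClockForm.lean, p159068); worker A3 also landed the deterministic flower-sandwich transfer for `discreteCrossing`
(…SlitCrossingTransfer.lean, p158501) and the HYP squeeze (…SlitCrossingSqueeze.lean, p158695).  Open: A1, A2, A3a, A3b.

## v6 (lead c2, 2026-08-17 pm): ORIENTATION.  `bondInterfaceIn` re-orients the NATIVE medial exploration by the
endpoint rule `orientCurve`; the native exploration starts at the `A`–`B` edge singled out by the start-corner parity,
which for a counter-clockwise Jordan loop is the one at `b` (refuters' `OrientationTax.lean` of crux 10814: on
`DobrushinDomain.unitDisc` with `UnitDiscDiscretisation.discData` the start corner is `((-M,0),3)`).  The domain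
Markov property lives on the native exploration's filtration, so STUB A3 now carries the hypothesis that along the
meshes the interface IS the class of the native polyline (no reversal), STUB A (`crossingMartingale_of_stubs`) the
same at family level, and the composition runs on the ORIENTED certified family of
`Theorems/CardyUniqueLimitCardyRigidityOrientedDisc.lean` (clockwise unit disc `unitDiscCW` + arc-swapped tilted data
`discDataSwap`, `OrientedDisc.exists_oriented_family`, p158253) instead of `unitDisc` + `stub_discretisable`.

## v5 (lead `prover-line-stmt-CriticalPhenomena-0746-c2-0`, 2026-08-17): RESHAPE of STUB A

v4 had ONE open stub, STUB A `stub_crossingMartingale` (every subsequential limit of the bond-`ℤ²`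
exploration interfaces carries a regular driver `W` with `± W` driving a.e. curve AND the level-stopped
`f`-crossing observables are martingales), handed back by lead c1 as crux-sized.  v5 keeps its statement
(now the THEOREM `crossingMartingale_of_stubs` below, modulo the new stubs) and cuts it along the
structure of Camia–Newman 2007 (held: PTRF 139) and of the tree's FK-Ising template
(`LatticeModels/FKIsingCylinderIdentityAssembly.lean`: (J) Kemppainen–Smirnov data + (D) discrete
martingale data ⇒ cylinder identities ⇒ natural-filtration martingales):

* STUB A1 `stub_percBoxTight : PercFaceBoxTight` — Kemppainen–Smirnov box tightness of the raw bond-`ℤ²`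
  medial exploration in the oriented face domains (KS 2017 Prop. 3.2 / Thms. 3.9–3.10 from Condition G2 =
  RSW; the research-level input of `PercKSBoxData`, SHARED with crux stmt-CriticalPhenomena-11389).
* STUB A2 `stub_percDrivingTail` — KS Prop. 3.8 tails of the discrete capacity driving processes (the `L³`
  clause of the regular driver), spelled out verbatim as the hypothesis `hTail` of the LANDED driver half
  `Driver.exists_regularDriver_perc` (file `…DriverHalf.lean`, p153138); it is literally
  `∀ D E, ZdDiscretisationFamily D E → Driver.PercDrivingTail D E` (def landed in `…DriverInputs.lean`,
  p156049, by `Iff.rfl`).  With A1 these give the driver clauses of STUB A and the convergence in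
  distribution of the discrete driving processes (`Driver.percLimitData_of_percKSBoxData`).
* STUB A3 `stub_slitCrossingData` — **the percolation heart, in the exact shape `hD` of the tree's PROVED
  passage theorem** `Loewner.integral_cylinder_eq_zero_of_discreteMartingales_of_ae_continuousAt`
  (`RandomPlanarGeometry/ObservableDiscretePassageAE.lean`): under the all-rectangle hypothesis, along the
  admissible meshes and approximating chordal maps of `PercKSBoxData`, for every admissible marks/levels and
  all `s < t`: at every scale a discrete filtration (the exploration filtration), a REAL bounded martingale
  (the conditional probability of the FIXED crossing event `Q = {(-x₂,-x₁) ↔ (-x₀, a) primal, inside D}`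
  given the exploration prefix — a Doob martingale by the domain Markov property, in the tree as
  `martingale_percSlitExpectation`), stopping times `σ ≤ τ ≤ M` (first steps of capacity `≥ s`, `≥ t`,
  cut off), such that the sign-reversed discrete driving values up to `s` are `𝒢_σ`-measurable and, off a
  small bad event, the stopped values are within `ε_k → 0` of the level-stopped observable
  `f(η_{u ∧ ρ})` of the sign-reversed discrete driving function at some `u ∈ [s, s + Δ_k]`, resp.
  `[t, t + Δ_k]`.  Its content: Camia–Newman's Theorem 3 (Cardy's formula for sequences of admissible slit
  domains, mesh → 0 simultaneously) transplanted to bond-`ℤ²` with Smirnov's theorem replaced by HYP — CN07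
  prove Thm 3 from POINTWISE Cardy on fixed piecewise-smooth Jordan domains by the deterministic
  flower-domain sandwich (their (12), construction of Lemma 7.3) plus continuity of the limit in the domain,
  so the kernel enters only through its continuity (landed `stub_kernelFacts`); the percolation estimates
  (RSW `rsw_half`, half-plane 3-arm, 6-arm) enter through the convergence of the discrete hull boundaries
  (CN07 Lemmas 6.1–6.4) and the close-encounter Lemmas 7.1–7.2; plus the capacity-clock bookkeeping of the
  discrete exploration (shared with stmt-11389's `PercParaClockData`).
* STUB A4 `stub_martingaleOfData` — **passage**, pure measure theory in the shape of
  `LatticeModels.exists_cylinderIdentityData_of_limitData`: a regular driver `W` (both signs, natural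
  filtration), discrete continuous-path processes `V^k → W` in distribution, and A3-type data for the
  observables of `-V^k` ⇒ `IsCrossingMartingaleFamily f μ (-W) (natural W)` (a.e.-continuity of the
  level-stopped functional at good levels, the passage theorem, monotone class, and the landed level
  extension `IsCrossingMartingaleFamily.of_innerLevels`, p153347).
* `crossingMartingale_of_stubs` — STUB A from A1–A4 (PROVED below); `CardyRigidity_of` unchanged (v2);
  `cardyRigidity_of_stubs` — the crux from A1–A4 and the landed `stub_kernelAffineCardy` (p152942).

Orientation (lead c1's `STUB-A-PROMOTE.md` §2, SEAT-C §4): `bondInterfaceIn` has the primal-wired arc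
`A = φ(ℝ₋)` on its LEFT; the one-sided marks of the observable sit on `A` at `-x₂ < -x₁ < -x₀ < 0`, i.e. at
`x₀ < x₁ < x₂` for the SIGN-REVERSED driver `-W` (`markFlow (-W) xᵢ = -markFlow W (-xᵢ)`, `cardyEta` is
invariant under `(a,b,c) ↦ (-a,-b,-c)`), and the conditional probability of `Q` given the exploration up to
`t` is the free crossing probability of the slit domain between the arcs `(-x₂,-x₁)` and
`(-x₀, tip) = (-x₀, a) ∪ left bank`, whose limit under HYP is `f (cardyEta X⁰ X¹ X²)`.  Hence `s = -1` in
STUB A.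

### Earlier records

* v4 (lead c1): STUB C′ `stub_kernelAffineCardy` LANDED (p152942); v2/v3 (lead …-0): vocabulary p144657,
  `stub_kernelFacts` p145789, merge of v1's analysis stubs B + C into C′; v1 (strategist cstrat-b1): the cut.
* Disproof / negatives: `Cruxes/CardyRigidity/Disproof.lean` (cdisprove v1.5): no `_false_without_` finer than
  the hypothesis itself (`¬ crux ↔ X_U ∧ ¬ CardyFormulaZ2`); `Negative/CrossingMartingaleTight.lean` (p145347):
  `√6 B` is a regular `I_{2/3}`-crossing-martingale driver (consistency of STUB A's conclusion at `f = F`);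
  `IsProbabilityMeasure` load-bearing.  stmt-0698 (`¬ SymmetryUpgrade`) not engaged.
-/

noncomputable section

open MeasureTheory Filter Set Topology Metric
open scoped NNReal ENNReal
open UpperHalfPlane (upperHalfPlaneSet)
open Literature.Probability Literature.Probability.RandomPlanarGeometry
  Literature.Probability.LatticeModels
open Literature.Probability.Percolation (bondDomainCrossingProb bondInterfaceIn BondConfig
  bondPercolation half measurable_bondInterfaceIn)
open Literature.Probability.Process (exitTime)
open scoped Literature.Probability.RandomPlanarGeometry.PathBorel
open Summit.CriticalPhenomena.CardyFormulaZ2.Cruxes.ParafermionToSLESixFamilies.CaratheodoryNetSlitUniformity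
  (PercKSBoxData PercFaceBoxTight)
open Summit.CriticalPhenomena.CardyFormulaZ2.Cruxes.ParafermionToSLESixFamilies.FaceKernel
  (percKSBoxData_of_boxTight)

namespace Summit.CriticalPhenomena.CardyFormulaZ2.Cruxes.CardyRigidity.CrossingMartingale

/-! ### STUB A1 — Kemppainen–Smirnov box tightness of the bond-`ℤ²` exploration (shared with stmt-11389) -/

/-- STUB A1 — **box tightness of the bond-`ℤ²` interfaces in the oriented face domains**
(`CaratheodoryNetSlitUniformity.PercFaceBoxTight`): Kemppainen–Smirnov's Prop. 3.2 with
Thms. 3.9–3.10 for the raw medial exploration polyline of critical bond percolation on `ℤ²`, from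
Condition G2 (Russo–Seymour–Welsh).  [cite: KemppainenSmirnov2017, Prop. 3.2, Thm. 3.9, Thm. 3.10] -/
theorem stub_percBoxTight : PercFaceBoxTight := by
  sorry

/-! ### STUB A2‴ — the deterministic annulus transfer behind Kemppainen–Smirnov's Condition G2 in `ℍ` -/

/-- STUB A2‴ — **the annulus transfer** (`Driver.PercFaceAnnulusTransfer`, vocabulary of
`Theorems/CardyUniqueLimitCardyRigidityFaceHalfPlaneG2OfTransfer.lean`, worker W2c of lead c2): the DETERMINISTIC half of
Condition G2 in `ℍ` for the bond-`ℤ²` exploration in the oriented face domains — (T1) a round half-annulus in `ℍ` of large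
ratio contains, through the chordal map of the face domain, two far-apart level cross-cuts (length–area), so that every
unforced crossing in `ℍ` forces a crossing of a genuine Euclidean annulus of ratio `C'` above the mesh scale; (T2) the
discrete past as a countable prefix statistic with determined fibres; (T3) side chains of the exploration turn the crossing
into a FRESH open-or-dual arm off the revealed edges.  (Kemppainen–Smirnov 2017, proof of Prop. 2.5/2.6, §2.2.)
[cite: KemppainenSmirnov2017, Prop. 2.6 and §2.2] -/
theorem stub_percFaceAnnulusTransfer : Driver.PercFaceAnnulusTransfer := by
  sorry

/-! ### STUB A2″ of v8 from A2‴ (landed probabilistic half `faceG2_percFaceHalfPlaneG2_of_annulusTransfer`, p163162) -/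

/-- **STUB A2″ of v8** (`Driver.PercFaceHalfPlaneG2`, Condition G2 in `ℍ` for the canonical face-domain system): from the
annulus transfer (A2‴) through the LANDED probabilistic half (RSW fresh arms `exists_const_freshArm_le_half`, decoupling
over the discrete past, a.s. Loewner pairs from box tightness). [cite: KemppainenSmirnov2017, §2.1.3, Prop. 4.7] -/
theorem percFaceHalfPlaneG2_of_stubs (hA2 : type_of% @stub_percFaceAnnulusTransfer) : Driver.PercFaceHalfPlaneG2 :=
  faceG2_percFaceHalfPlaneG2_of_annulusTransfer hA2

/-! ### STUB A2 of v5–v7 from A1 and A2‴ (landed `Driver.percDrivingTail_of_face`) -/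

/-- **STUB A2 of v5–v7** (`stub_percDrivingTail`, statement unchanged = `∀ D E, ZdDiscretisationFamily D E →
Driver.PercDrivingTail D E` unfolded): the Kemppainen–Smirnov Prop. 3.8 tails of the discrete driving processes, from
box tightness (A1) and Condition G2 in `ℍ` (A2″) through the landed limit-tail bridge
(`Driver.percDrivingTail_of_face` = `…_of_limitTail` ∘ `limitTail_of_face`). [cite: KemppainenSmirnov2017, Prop. 3.8] -/
theorem percDrivingTail_of_stubs (hA1 : type_of% @stub_percBoxTight) (hA2 : type_of% @stub_percFaceAnnulusTransfer) :
    ∀ (D : DobrushinDomain) (E : ℝ → DiscreteDobrushin), ZdDiscretisationFamily D E →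
    ∀ φ : ConformalEquiv upperHalfPlaneSet D.carrier, D.IsChordalUniformizing φ →
    ∀ δs : ℕ → ℝ, (∀ k, 0 < δs k) → Tendsto δs atTop (𝓝 0) →
      (∀ k, (E (δs k)).IsZdAdmissible) →
    ∀ (Ds : ℕ → DobrushinDomain) (φs : ∀ k, ConformalEquiv upperHalfPlaneSet (Ds k).carrier),
      (∀ k, (Ds k).IsChordalUniformizing (φs k)) →
      (∀ R : ℝ, TendstoUniformlyOn (fun k ↦ (φs k).boundaryExtension) φ.boundaryExtension
        atTop ({z : ℂ | 0 ≤ z.im} ∩ closedBall 0 R)) →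
      (∀ ε : ℝ, 0 < ε → ∃ r : ℝ, ∀ᶠ k in atTop, ∀ z : ℂ, z ∈ {z : ℂ | 0 ≤ z.im} → r ≤ ‖z‖ →
        dist ((φs k).boundaryExtension z) ((Ds k).pt 1) ≤ ε) →
      Tendsto (fun k ↦ (Ds k).pt 1) atTop (𝓝 (D.pt 1)) →
      (∀ ε : ℝ≥0∞, 0 < ε → ∃ (δγ δW : ℕ → ℝ) (T : ℕ → ℝ≥0), (∀ j, 0 < δγ j) ∧
        (∀ j, 0 < δW j) ∧
        ∀ k, bondPercolation (zdGraph 2) half ((bondInterfaceIn D (E (δs k))) ⁻¹'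
          ((fun p ↦ compactifiedClass (φs k).boundaryExtension ((Ds k).pt 1) p.1) ''
            {p : C(ℝ≥0, ℂ) × C(ℝ≥0, ℝ) | p ∈ generatedPairs ∧
              p.1 ∈ Process.modulusSet ({0} : Set ℂ) δγ ∧
              p.2 ∈ Process.modulusSet ({0} : Set ℝ) δW ∧
              ∀ (j : ℕ) (t : ℝ≥0), T j ≤ t → (j : ℝ) ≤ ‖p.1 t‖})ᶜ) ≤ ε) →
    ∀ t : ℝ≥0, ∃ (K r : ℝ) (n₀ : ℕ), 0 < r ∧ ∀ n : ℕ, n₀ ≤ n → ∀ᶠ k in atTop,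
      bondPercolation (zdGraph 2) half {ω | ∃ u, u ≤ t ∧
        (n : ℝ) < |drivingFunction (φs k) (bondInterfaceIn D (E (δs k)) ω) u|} ≤
        ENNReal.ofReal (K * Real.exp (-r * n)) :=
  fun D E hE ↦ Driver.percDrivingTail_of_face hA1 (percFaceHalfPlaneG2_of_stubs hA2) D E hE

/-! ### STUB A3a `stub_percCapacityClock : PercCapacityClockH` — LANDED (`Theorems/CardyUniqueLimitCardyRigidityStubPercCapacityClock.lean`, p165367, worker W2a of lead c2), imported -/

/-! ### STUB A3b — the slit crossing probabilities track the crossing observable (Camia–Newman Thm 3 under HYP) -/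

/-- STUB A3b — **THE HEART** (`PercSlitObservableApprox f`): under the all-rectangle hypothesis, along the KS data
and the orientation hypothesis, for admissible marks/levels and every horizon, eventually in `k`, the percolation
slit expectations of the level-frozen conditional crossing probability of the fixed event `(-x₂,-x₁) ↔ (-x₀, a)` are,
off a small event, within `ε_k → 0` of the level-stopped crossing observable of the sign-reversed discrete driving
function at the capacity time of the explored piece (Camia–Newman's Theorem 3 with Smirnov's theorem replaced by
HYP: flower sandwich = landed `slitCrossing_discreteCrossing_subset_of_margins` p158501 + `…_of_sandwich` p158695,
hull-boundary convergence / close encounters CN07 §§6–7 for bond-`ℤ²`).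
[cite: CamiaNewman2007, Thm 3, Lemmas 6.1–6.4, 7.1–7.3] [cite: Smirnov2001, Thm 2] -/
theorem stub_slitObservableApprox : ∀ f : ℝ → ℝ, AllRectangleKernel f → PercSlitObservableApprox f := by
  sorry

/-! ### STUB A3 of v5/v6 from A3a, A3b (landed cut `percCrossingClockForm_of` + packaging `slitCrossing_data_of_clockForm`) -/

/-- **STUB A3 of v5/v6** (`stub_slitCrossingData`, statement unchanged): the hypothesis `hD` of the AE passage theorem
for the level-stopped crossing observable of the sign-reversed discrete driving functions, from the capacity clock
(A3a) and the slit-observable estimate (A3b) through the landed clock-form cut and packaging.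
[cite: CamiaNewman2007, §5 and Thm 3] -/
theorem slitCrossingData_of_stubs (hA3a : type_of% @stub_percCapacityClock)
    (hA3b : type_of% @stub_slitObservableApprox) :
    ∀ f : ℝ → ℝ, AllRectangleKernel f →
    ∀ (D : DobrushinDomain) (E : ℝ → DiscreteDobrushin), ZdDiscretisationFamily D E →
    ∀ φ : ConformalEquiv upperHalfPlaneSet D.carrier, D.IsChordalUniformizing φ →
    ∀ δs : ℕ → ℝ, (∀ k, 0 < δs k) → Tendsto δs atTop (𝓝 0) →
      (∀ k, (E (δs k)).IsZdAdmissible) →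
      (∀ᶠ k in atTop, ∀ ω, bondInterfaceIn D (E (δs k)) ω =
        CurveClass.mk ⟨medialExplorationCurve (E (δs k)) ω⟩) →
    ∀ (Ds : ℕ → DobrushinDomain) (φs : ∀ k, ConformalEquiv upperHalfPlaneSet (Ds k).carrier),
      (∀ k, (Ds k).IsChordalUniformizing (φs k)) →
      (∀ R : ℝ, TendstoUniformlyOn (fun k ↦ (φs k).boundaryExtension) φ.boundaryExtension
        atTop ({z : ℂ | 0 ≤ z.im} ∩ closedBall 0 R)) →
      (∀ ε : ℝ, 0 < ε → ∃ r : ℝ, ∀ᶠ k in atTop, ∀ z : ℂ, z ∈ {z : ℂ | 0 ≤ z.im} → r ≤ ‖z‖ →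
        dist ((φs k).boundaryExtension z) ((Ds k).pt 1) ≤ ε) →
      Tendsto (fun k ↦ (Ds k).pt 1) atTop (𝓝 (D.pt 1)) →
      (∀ ε : ℝ≥0∞, 0 < ε → ∃ (δγ δW : ℕ → ℝ) (T : ℕ → ℝ≥0), (∀ j, 0 < δγ j) ∧
        (∀ j, 0 < δW j) ∧
        ∀ k, bondPercolation (zdGraph 2) half ((bondInterfaceIn D (E (δs k))) ⁻¹'
          ((fun p ↦ compactifiedClass (φs k).boundaryExtension ((Ds k).pt 1) p.1) ''
            {p : C(ℝ≥0, ℂ) × C(ℝ≥0, ℝ) | p ∈ generatedPairs ∧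
              p.1 ∈ Process.modulusSet ({0} : Set ℂ) δγ ∧
              p.2 ∈ Process.modulusSet ({0} : Set ℝ) δW ∧
              ∀ (j : ℕ) (t : ℝ≥0), T j ≤ t → (j : ℝ) ≤ ‖p.1 t‖})ᶜ) ≤ ε) →
    ∀ (x : Fin 3 → ℝ) (m M d : ℝ), AdmissibleLevels x m M d →
    ∀ s t : ℝ≥0, s < t →
      ∃ ε Δ η : ℕ → ℝ≥0, Tendsto ε atTop (𝓝 0) ∧ Tendsto Δ atTop (𝓝 0) ∧
        Tendsto η atTop (𝓝 0) ∧
        ∀ k, ∃ (𝒢 : Filtration ℕ (inferInstance : MeasurableSpace (BondConfig (Site 2))))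
          (F : ℕ → BondConfig (Site 2) → ℝ) (σ τ : BondConfig (Site 2) → WithTop ℕ)
          (hσ : IsStoppingTime 𝒢 σ) (Mk : ℕ) (bad : Set (BondConfig (Site 2))),
          IsStoppingTime 𝒢 τ ∧ Martingale F 𝒢 (bondPercolation (zdGraph 2) half) ∧ σ ≤ τ ∧
          (∀ ω, τ ω ≤ Mk) ∧
          (∀ u, u ≤ s → Measurable[hσ.measurableSpace] fun ω ↦
            -drivingFunction (φs k) (bondInterfaceIn D (E (δs k)) ω) u) ∧
          (∀ᵐ ω ∂bondPercolation (zdGraph 2) half, ‖stoppedValue F σ ω‖ ≤ 1) ∧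
          (∀ᵐ ω ∂bondPercolation (zdGraph 2) half, ‖stoppedValue F τ ω‖ ≤ 1) ∧
          MeasurableSet bad ∧ bondPercolation (zdGraph 2) half bad ≤ η k ∧
          ∀ᵐ ω ∂bondPercolation (zdGraph 2) half, ω ∉ bad →
            (∃ u ∈ Icc s (s + Δ k), ‖stoppedValue F σ ω -
              crossingObs f (fun (w : C(ℝ≥0, ℝ)) (r : ℝ≥0) ↦ w r) x m M d u
                ⟨fun r ↦ -drivingFunction (φs k) (bondInterfaceIn D (E (δs k)) ω) r,
                  (continuous_drivingFunction (φs k) (bondInterfaceIn D (E (δs k)) ω)).neg⟩‖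
                ≤ ε k) ∧
            (∃ u ∈ Icc t (t + Δ k), ‖stoppedValue F τ ω -
              crossingObs f (fun (w : C(ℝ≥0, ℝ)) (r : ℝ≥0) ↦ w r) x m M d u
                ⟨fun r ↦ -drivingFunction (φs k) (bondInterfaceIn D (E (δs k)) ω) r,
                  (continuous_drivingFunction (φs k) (bondInterfaceIn D (E (δs k)) ω)).neg⟩‖
                ≤ ε k) := by
  intro f hf D E hE φ hφ δs hδpos hδ0 hδadm hor Ds φs hφs hU1 hU2 hb hbox x m M d hx s t hst
  have hCF : PercCrossingClockForm f := capClock_percCrossingClockForm_ofH hA3a (hA3b f hf)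
  have hCF' := hCF D E hE φ hφ δs hδpos hδ0 hδadm hor Ds φs hφs hU1 hU2 hb hbox x m M d hx s t hst
  have hVm : ∀ k u, Measurable fun ω ↦
      -drivingFunction (φs k) (bondInterfaceIn D (E (δs k)) ω) u := fun k u ↦
    ((measurable_drivingFunction_apply (hφs k) u).comp (measurable_bondInterfaceIn D (E (δs k)))).neg
  exact slitCrossing_data_of_clockForm (bondPercolation (zdGraph 2) half)
    (fun k u ω ↦ -drivingFunction (φs k) (bondInterfaceIn D (E (δs k)) ω) u) hVm
    (fun k u ω ↦ crossingObs f (fun (w : C(ℝ≥0, ℝ)) (r : ℝ≥0) ↦ w r) x m M d u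
      ⟨fun r ↦ -drivingFunction (φs k) (bondInterfaceIn D (E (δs k)) ω) r,
        (continuous_drivingFunction (φs k) (bondInterfaceIn D (E (δs k)) ω)).neg⟩) s t hst hCF'

/-! ### STUB A4 `stub_martingaleOfData` — LANDED (`Theorems/CardyUniqueLimitCardyRigidityMartingaleOfData.lean`, worker A4 of lead c2), imported -/

/-! ### STUB A of v1–v4 from A1–A4 -/

/-- Convergence in distribution of path-valued maps is unchanged when the limit map is modified on a
null set. [folklore] -/
theorem tendstoInDistribution_congr_ae {Ω Ω' E : Type*} [MeasurableSpace Ω] [MeasurableSpace Ω']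
    [TopologicalSpace E] [MeasurableSpace E] [OpensMeasurableSpace E]
    {μ : Measure Ω} [IsProbabilityMeasure μ] {P : ℕ → Measure Ω'} [∀ k, IsProbabilityMeasure (P k)]
    {X : ℕ → Ω' → E} {Z Z' : Ω → E} (h : TendstoInDistribution X atTop Z P μ)
    (hZZ' : Z =ᵐ[μ] Z') (hZ' : AEMeasurable Z' μ) : TendstoInDistribution X atTop Z' P μ := by
  refine ⟨h.forall_aemeasurable, hZ', ?_⟩
  have hmap : μ.map Z = μ.map Z' := Measure.map_congr hZZ'
  have := h.tendsto
  simpa only [hmap] using this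

/-- **STUB A of v1–v4** (`stub_crossingMartingale`, registered 2026-08-17T05:3xZ; statement unchanged) from
STUBS A1–A4: the KS inputs give the regular driver `W = drivingFunction φ` (both signs) and the convergence
in distribution of the discrete driving processes along admissible meshes (landed driver half); A3 supplies
the discrete crossing-martingale data along the same meshes; A4 passes to the limit; the sign is `s = -1`.
[cite: KemppainenSmirnov2017, Thm 1.3] [cite: CamiaNewman2007, §§5–7] [cite: Smirnov2001, Thm 2] -/
theorem crossingMartingale_of_stubs (hA1 : type_of% @stub_percBoxTight)
    (hA2 : type_of% @stub_percFaceAnnulusTransfer) (hA3a : type_of% @stub_percCapacityClock)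
    (hA3b : type_of% @stub_slitObservableApprox) (hA4 : type_of% @stub_martingaleOfData) :
    ∀ f : ℝ → ℝ, AllRectangleKernel f →
      ∀ (D : DobrushinDomain) (E : ℝ → DiscreteDobrushin), ZdDiscretisationFamily D E →
        (∀ᶠ δ in 𝓝[>] (0 : ℝ), ∀ ω, bondInterfaceIn D (E δ) ω =
          CurveClass.mk ⟨medialExplorationCurve (E δ) ω⟩) →
      ∀ μ : Measure (CurveClass ℂ), IsProbabilityMeasure μ →
        IsSubseqLimitLaw (fun δ ↦ bondInterfaceIn D (E δ)) (fun _ ↦ bondPercolation (zdGraph 2) half) μ →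
      ∀ φ : ConformalEquiv upperHalfPlaneSet D.carrier, D.IsChordalUniformizing φ →
        ∃ (W : CurveClass ℂ → ℝ≥0 → ℝ)
          (𝓕 : Filtration ℝ≥0 (inferInstance : MeasurableSpace (CurveClass ℂ))) (s : ℝ),
          (s = 1 ∨ s = -1) ∧ IsRegularDriver μ W 𝓕 ∧
          (∀ᵐ c ∂μ, Loewner.IsDrivenBy φ.boundaryExtension (D.pt 1) (fun t ↦ s * W c t) c) ∧
          IsCrossingMartingaleFamily f μ W 𝓕 := by
  intro f hf D E hE hOr μ hμ hlim φ hφ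
  haveI := hμ
  -- kernel facts: continuity of `f` on (0,1)
  have hcont : ContinuousOn f (Ioo 0 1) := (stub_kernelFacts f hf).1
  -- (J): describability, admissible meshes, approximating maps, driving convergence (landed driver half)
  have hKS : PercKSBoxData := percKSBoxData_of_boxTight hA1
  obtain ⟨-, -, δs, Ds, φs, hδpos, hδ0, hδadm, hφs, hU1, hU2, hb, hbox, hTD⟩ :=
    Driver.percLimitData_of_percKSBoxData hKS hE hlim hφ
  -- the regular driver (both signs), `W = drivingFunction φ` a.e., driving a.e. curve
  obtain ⟨W, hWm, hreg, hreg', hWdf, hdrv⟩ :=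
    Driver.exists_regularDriver_perc hKS (percDrivingTail_of_stubs hA1 hA2) D E hE μ hlim φ hφ
  have hWc : ∀ c, Continuous (W c) := hreg.2.1
  -- orientation along the meshes: the interface is the native exploration itself
  have hδw : Tendsto δs atTop (𝓝[>] (0 : ℝ)) :=
    tendsto_nhdsWithin_iff.2 ⟨hδ0, Eventually.of_forall fun k ↦ hδpos k⟩
  have hOrk : ∀ᶠ k in atTop, ∀ ω, bondInterfaceIn D (E (δs k)) ω =
      CurveClass.mk ⟨medialExplorationCurve (E (δs k)) ω⟩ := hδw.eventually hOr
  -- (D): the discrete crossing-martingale data along the same meshes (STUB A3)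
  have hdata := slitCrossingData_of_stubs hA3a hA3b f hf D E hE φ hφ δs hδpos hδ0 hδadm hOrk Ds φs hφs
    hU1 hU2 hb hbox
  -- driving convergence towards `W` itself
  have hTD' : TendstoInDistribution
      (fun k ω ↦ (⟨fun u ↦ drivingFunction (φs k) (bondInterfaceIn D (E (δs k)) ω) u,
        continuous_drivingFunction (φs k) (bondInterfaceIn D (E (δs k)) ω)⟩ : C(ℝ≥0, ℝ)))
      atTop (fun c ↦ (⟨fun u ↦ W c u, hWc c⟩ : C(ℝ≥0, ℝ)))
      (fun _ ↦ bondPercolation (zdGraph 2) half) μ := by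
    haveI : ∀ k : ℕ, IsProbabilityMeasure ((fun _ : ℕ ↦ bondPercolation (zdGraph 2) half) k) :=
      fun _ ↦ by dsimp only; infer_instance
    have hae : (fun c ↦ (⟨drivingFunction φ c, continuous_drivingFunction φ c⟩ : C(ℝ≥0, ℝ))) =ᵐ[μ]
        fun c ↦ (⟨fun u ↦ W c u, hWc c⟩ : C(ℝ≥0, ℝ)) := by
      filter_upwards [hWdf] with c hc
      ext u
      simp [hc]
    have hZm : AEMeasurable (fun c ↦ (⟨fun u ↦ W c u, hWc c⟩ : C(ℝ≥0, ℝ))) μ :=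
      (hTD.aemeasurable_limit).congr hae
    exact tendstoInDistribution_congr_ae hTD hae hZm
  -- passage (STUB A4) with the sign `s = -1`
  have hmart : IsCrossingMartingaleFamily f μ (fun c t ↦ -W c t)
      (Filtration.natural (fun t c ↦ W c t) hWm) :=
    hA4 f hcont μ W hWm hWc hreg hreg' (bondPercolation (zdGraph 2) half)
      (fun k u ω ↦ drivingFunction (φs k) (bondInterfaceIn D (E (δs k)) ω) u)
      (fun k ω ↦ continuous_drivingFunction (φs k) (bondInterfaceIn D (E (δs k)) ω)) hTD' hdata
  refine ⟨fun c t ↦ -W c t, Filtration.natural (fun t c ↦ W c t) hWm, -1, Or.inr rfl, hreg', ?_, hmart⟩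
  filter_upwards [hdrv] with c hc
  simpa only [neg_mul, one_mul, neg_neg] using hc

/-! ### STUB C′ `stub_kernelAffineCardy` — LANDED (p152942, `Theorems/CardyUniqueLimitCardyRigidityStubKernelAffineCardy.lean`), imported -/

/-! ### Composition: STUB A (now a theorem modulo A1–A4) and STUB C′ imply the crux BY NAME -/

/-- **The skeleton theorem (v2).**  STUB A and STUB C′, together with the landed `stub_kernelFacts`,
imply `CardyRigidity` (stmt-CriticalPhenomena-0746; the same `Prop` in all nine route files).
[cite: Smirnov2001, Thm 2] [cite: LawlerSchrammWerner2001, §3] -/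
theorem CardyRigidity_of (hA : type_of% @(crossingMartingale_of_stubs))
    (hA1 : type_of% @stub_percBoxTight) (hA2 : type_of% @stub_percFaceAnnulusTransfer)
    (hA3a : type_of% @stub_percCapacityClock) (hA3b : type_of% @stub_slitObservableApprox)
    (hA4 : type_of% @stub_martingaleOfData) (hC : type_of% @stub_kernelAffineCardy) :
    Summit.CriticalPhenomena.CardyFormulaZ2.Theses.CardyUniqueLimit.CardyRigidity := by
  intro f hf
  -- a subsequential limit of the bond-ℤ² exploration interfaces of the ORIENTED certified family
  -- (clockwise unit disc, arc-swapped tilted data: the interface is the native exploration itself)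
  obtain ⟨D₀, E₀, hE₀, hOr₀⟩ := OrientedDisc.exists_oriented_family
  have hOr₀' : ∀ᶠ δ in 𝓝[>] (0 : ℝ), ∀ ω, bondInterfaceIn D₀ (E₀ δ) ω =
      CurveClass.mk ⟨medialExplorationCurve (E₀ δ) ω⟩ := hOr₀.mono fun δ h ↦ h.2
  have hT := hE₀.isTightAlongMesh_bondInterfaceIn
  have hmeas : ∀ᶠ δ in 𝓝[>] (0 : ℝ),
      AEMeasurable (bondInterfaceIn D₀ (E₀ δ)) (bondPercolation (zdGraph 2) half) :=
    Eventually.of_forall fun δ ↦ (measurable_bondInterfaceIn D₀ (E₀ δ)).aemeasurable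
  obtain ⟨μ, hμ, hlim⟩ := hT.exists_isSubseqLimitLaw hmeas
  obtain ⟨φ, hφ⟩ := MarkedDomain.exists_isChordalUniformizing_holds D₀
  -- STUB A: a regular driving process with the crossing-martingale property for `f`
  obtain ⟨W, 𝓕, s, -, hreg, -, hmart⟩ := hA hA1 hA2 hA3a hA3b hA4 f hf D₀ E₀ hE₀ hOr₀' μ hμ hlim φ hφ
  -- landed STUB D: kernel facts
  obtain ⟨hcont, hf0, hf1⟩ := stub_kernelFacts f hf
  -- STUB C′: `f = A I_{2/3} + B` on (0,1)
  haveI := hμ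
  obtain ⟨A, B, hfab⟩ := hC f hcont (CurveClass ℂ) μ W 𝓕 hreg hmart
  -- the boundary values of `f` along the affine form: `B = 0`, `A = 1`
  have hev0 : ∀ᶠ η in 𝓝[>] (0 : ℝ), f η = A * betaLaw (2 / 3) η + B :=
    Filter.eventually_of_mem (Ioo_mem_nhdsGT zero_lt_one) fun η hη ↦ hfab hη
  have hev1 : ∀ᶠ η in 𝓝[<] (1 : ℝ), f η = A * betaLaw (2 / 3) η + B :=
    Filter.eventually_of_mem (Ioo_mem_nhdsLT zero_lt_one) fun η hη ↦ hfab hη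
  have hlim0 : Tendsto f (𝓝[>] 0) (𝓝 (A * 0 + B)) :=
    ((tendsto_betaLaw_two_thirds_zero.const_mul A).add_const B).congr'
      (hev0.mono fun η hη ↦ hη.symm)
  have hlim1 : Tendsto f (𝓝[<] 1) (𝓝 (A * 1 + B)) :=
    ((tendsto_betaLaw_two_thirds_one.const_mul A).add_const B).congr'
      (hev1.mono fun η hη ↦ hη.symm)
  have hB0 : B = 0 := by
    have := tendsto_nhds_unique hlim0 hf0
    simpa using this
  have hA1' : A = 1 := by
    have := tendsto_nhds_unique hlim1 hf1
    rw [hB0] at this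
    simpa using this
  -- conclusion: `f = I_{2/3} = F` on (0,1)
  intro η hη
  have hfη : f η = A * betaLaw (2 / 3) η + B := hfab hη
  rw [hfη, hA1', hB0, one_mul, add_zero, betaLaw_two_thirds]
  exact (cardyFunction_eq_incBeta13_div_holds η (Ioo_subset_Icc_self hη)).symm

/-- The composition applied to the registered stubs: the crux, conditionally on STUBS A1–A4 (the only
`sorry`s of this file; `stub_kernelAffineCardy` is the landed theorem). [folklore] -/
theorem cardyRigidity_of_stubs :
    Summit.CriticalPhenomena.CardyFormulaZ2.Theses.CardyUniqueLimit.CardyRigidity :=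
  CardyRigidity_of crossingMartingale_of_stubs stub_percBoxTight stub_percFaceAnnulusTransfer
    stub_percCapacityClock stub_slitObservableApprox stub_martingaleOfData stub_kernelAffineCardy

end Summit.CriticalPhenomena.CardyFormulaZ2.Cruxes.CardyRigidity.CrossingMartingale

end
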